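import Summits.QuantumFields.BalabanUV.Beta.GAN24.GaugeTableCellByParts

/-!
# `BalabanUV.Beta.GAN24.BoundaryFluxFaceCount` — binder row G-an2-4 ∕ (CONV-C), W-slot CT-W, route «WC-TL» ∕ «QR-LL», the located scalar K-LL-4′ of RULING
# R-gan24p1-g29-1 + A1 (journal l.44562 ∕ l.44793), HANDS (ii) (leaf-01): **THE SUPPORT-WEIGHTED KERNEL-ONLY GAIN OF THE FLUX RECURSION — ONE OUTPUT ENTRY OF
# `c • mmRead N (K ∘ Φ̂ ∘ K)` IS BOUNDED BY `|c|·|Fib|²·h_L·h_R·B_Φ·Z_{m′}·Σ'_p ω(p)·E_x(p)`: THE FLUX MASS IN THE OUTPUT's BLOCK WINDOW, DISPLAYED**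
# (the complement of leaf-03 g62's support-blind `BlockFluxRegion.abs_regionSum_divV_e3OfK_le`, WANTED by their W-2, journal l.44999)

NOT IN PRINT; OUR BOOKKEEPING ([folklore] two `tsum_of_norm_bounded` steps + leaf-01 g66's weighted Fubini `GaugeTableCellByParts.tsum_tsum_weight`; G-an2-4 formalisation
swarm → CRUX TEAM (2), leaf prover `b2b-balaban-gan24-formalise-leaf-01`, gen 67; my R-1 l.44982 ∕ note `HOME/b2b-balaban-gan24-formalise-leaf-01/g67/RHO-PHI-COUNT-v1.md`).
HONEST FRAMING (cell contract, verbatim): «discharging `BetaPertH` makes Bałaban's UV stability UNCONDITIONAL — a real constructive-QFT result; it is NOT the continuum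
limit and NOT the Clay problem.»  HONEST DEPENDENCY (verbatim): «continuum YM on T⁴ ⇐ BetaPertH ∧ nine spine estimates (0/9 proved); BetaPertH ⇐ (D1) ∧ (D4) ∧ CAP+tail;
G-an2-4 gates asym, D1 and NE2/3/4.»

## Why
The OWNER's exact flux recursion (`BoundaryFluxRecursion.boxSum_divV_e3OfK(_comb)`, A1) transports the block flux of a letter by the KERNEL SANDWICH ALONE:
`Φ_{j+1} = −c_H • mmRead N (K ∘ Φ̂_j ∘ K)`.  Bounding the sandwich from `Decays K C δ` and a UNIFORM bound `Bdd Φ̂ B_Φ` (leaf-03 g62 §3) is true and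
support-blind: it lets `Φ̂` fill the whole block pair, and for the END's `K♮ᴱ_j` in `unitS` currency the constant `|c_H|·(C·Z_δ)²` × the step weight `Lc^{3(d+1)}` is
`≍ Lc^{2d}`.  THIS file keeps the SUPPORT of `Φ̂`: with the left kernel leg bounded by a block window `h_L·E_x(p)` (`0 ≤ E ≤ 1`; the (N1) shape
`A·(Lc^{d+2})⁻¹·e^{−κ₀‖quo Lc p − x‖}`), the right leg by its sup `h_R`, and the flux kernel by a SLOT WEIGHT times a kernel-range decay `B_Φ·ω(p)·e^{−m′‖q−p‖₁}` (the
(LAY) row's profile shape, `ω` = the face weight of the boundary sub-letter, summable), ONE output entry is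
`≤ |c|·|Fib d|²·h_L·h_R·B_Φ·Zl(m′)·Σ'_p ω(p)·E_x(p)` — the flux mass the output block's window sees.  READING (R-1 (ii), a count, not asserted): for a face weight
`Σ'_p ω(p)E_x(p) ≍ Lc^d` (the face plaquettes of ONE block), and with `|c| = Lc^{2(d+1)}`, `h_L = h_R = A·Lc^{−(d+2)}` this is `A²·Lc^{d−2}` per level in the END's
sup-entry currency — `Lc^{+1}` at `d = 3`, `Lc^{−1}` at the engine's `d = 1`.
§1 `abs_comp_le_weighted` (inner composition against the weighted flux), **`abs_smul_mmRead_sandwich_le_faceMass`** (the display, one entry),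
**`bdd_smul_mmRead_sandwich_of_faceMass`** (the `Bdd` currency of leaf-03's sockets: constant `|c|·|Fib|²·h_L·h_R·B_Φ·Zl(m′)·M_F`, `M_F = sup_x Σ'_p ω(p)E_x(p)`).
§2 `exp_profile_le_split`, **`abs_finsetSum_divV_le_of_profile`** (the flux kernel of a letter through ANY finite region under the (LAY) profile row `Cs·ω(u)·e^{−m′(…)}` HAS
§1's shape: `B_Φ = Cs`, `ω_Φ(p) = Σ_{u∈R} ω̃(u)e^{−(m′/2)‖p−u‖₁}`, rate `m′/2`), `summable_regionWeight` — so §1 is instantiable from the END's displayed rows `hS ∕ hω` alone.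
Asserts NO size of any leg or letter; decides nothing about (Q-R) ∕ K-LL-4′; [folklore]; 0 cited facts, 0 `def`, 0 `def … : Prop`, 0 sorry.  NEVER «G-an2-4 closed» as
(CONV-C); NOT D1, NOT `BetaPertH`, NOT continuum, NOT Clay.  2026-08-22; no existing file touched.
-/

noncomputable section

open Finset
open scoped BigOperators
open Literature.MathematicalPhysics.QuantumFieldTheory
open Literature.MathematicalPhysics.QuantumFieldTheory.Balaban1983to89
open Literature.MathematicalPhysics.QuantumFieldTheory.Balaban1983to89.Beta
open B12Sec2to5 (l1 l1_nonneg)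
open ExpKernelCalculus (MKer Site comp Zl Zl_nonneg summable_exp_shift summable_exp_shift' tsum_exp_shift l1_sub_triangle l1_sub_symm)
open OneStepResolventKernel (Fib)
open BalabanStepJetsSucc (mmRead mmRead_inl_inl)
open KernelWard (divV)
open Summit.QuantumFields.BalabanUV.Beta.GAN24.GaugeTableSlotByParts (abs_divV_apply_le_of_profile)
open Summit.QuantumFields.BalabanUV.Beta.GAN24.GaugeTableCellByParts (tsum_tsum_weight)

namespace Summit.QuantumFields.BalabanUV.Beta.GAN24.BoundaryFluxFaceCount

variable {d : ℕ}

section Sandwich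

variable {K V : MKer (d + 1) (Fib d)} {N : ℕ} {E : Site (d + 1) → Site (d + 1) → ℝ} {ω : Site (d + 1) → ℝ} {hL hR BΦ m' : ℝ}
  (hhL : 0 ≤ hL) (hB : 0 ≤ BΦ) (hm : 0 < m')
  (hE : ∀ x p, 0 ≤ E x p ∧ E x p ≤ 1) (hω : ∀ p, 0 ≤ ω p) (hωs : Summable ω)
  (hKL : ∀ (x : Site (d + 1)) (α : Fin (d + 1)) (p : Site (d + 1)) (f : Fib d), |K ((N : ℤ) • x) p (Sum.inr α) f| ≤ hL * E x p)
  (hKR : ∀ (q z : Site (d + 1)) (f : Fib d) (β : Fin (d + 1)), |K q ((N : ℤ) • z) f (Sum.inr β)| ≤ hR)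
  (hV : ∀ (p q : Site (d + 1)) (f g : Fib d), |V p q f g| ≤ BΦ * ω p * Real.exp (-m' * l1 (q - p)))

include hm hE hω hωs hKL hV in
/-- [folklore] **THE LEFT KERNEL LEG AGAINST THE WEIGHTED FLUX**: for every middle index `q` and legs `α, g`,
`|(K ∘ V) (N•x) q (inr α) g| ≤ |Fib d|·h_L·B_Φ·Σ'_p ω(p)·e^{−m′‖q−p‖₁}·E(p)` (the window `E` of the left leg against the slot weight `ω` of the flux). -/
theorem abs_comp_le_weighted (x q : Site (d + 1)) (α : Fin (d + 1)) (g : Fib d) :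
    |comp K V ((N : ℤ) • x) q (Sum.inr α) g|
      ≤ (Fintype.card (Fib d) : ℝ) * (hL * BΦ * ∑' p, ω p * Real.exp (-m' * l1 (q - p)) * E x p) := by
  obtain ⟨h1, -, -⟩ := tsum_tsum_weight (a := ω) (m' := m') hm hω hωs (w := E x) (fun p => (hE x p).1) (fun p => (hE x p).2)
  have hs : Summable fun p => ω p * Real.exp (-m' * l1 (q - p)) * E x p := h1 q
  unfold ExpKernelCalculus.comp
  have hmaj := ((hs.mul_left (hL * BΦ)).mul_left (Fintype.card (Fib d) : ℝ))
  have hb := tsum_of_norm_bounded hmaj.hasSum (fun p => by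
    rw [Real.norm_eq_abs]
    calc |∑ f, K ((N : ℤ) • x) p (Sum.inr α) f * V p q f g| ≤ ∑ f, |K ((N : ℤ) • x) p (Sum.inr α) f * V p q f g| := Finset.abs_sum_le_sum_abs _ _
      _ ≤ ∑ _f : Fib d, hL * E x p * (BΦ * ω p * Real.exp (-m' * l1 (q - p))) := Finset.sum_le_sum fun f _ => by
          rw [abs_mul]
          exact mul_le_mul (hKL x α p f) (hV p q f g) (abs_nonneg _) ((abs_nonneg _).trans (hKL x α p f))
      _ = (Fintype.card (Fib d) : ℝ) * (hL * BΦ * (ω p * Real.exp (-m' * l1 (q - p)) * E x p)) := by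
          rw [Finset.sum_const, Finset.card_univ, nsmul_eq_mul]; ring)
  rw [Real.norm_eq_abs] at hb
  refine hb.trans (le_of_eq ?_)
  rw [tsum_mul_left, tsum_mul_left]

include hhL hB hm hE hω hωs hKL hKR hV in
/-- NOT IN PRINT; OUR BOOKKEEPING.  **THE SUPPORT-WEIGHTED KERNEL-ONLY GAIN OF THE FLUX RECURSION** (one output entry): with the left kernel leg windowed by `h_L·E`
(`0 ≤ E ≤ 1`), the right leg bounded by `h_R`, and the flux kernel bounded by `B_Φ·ω(p)·e^{−m′‖q−p‖₁}` (`ω ≥ 0` summable, `m′ > 0`),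
`|(c • mmRead N (K ∘ V ∘ K)) x z (inl α) (inl β)| ≤ |c|·|Fib d|²·h_L·h_R·B_Φ·Zl(m′)·Σ'_p ω(p)·E(p)` — THE FLUX MASS IN THE OUTPUT's WINDOW, displayed; no decay constant of `K`
squared, no `Z_δ²`.  (The `inr` rows and columns of the `mm`-read vanish.) -/
theorem abs_smul_mmRead_sandwich_le_faceMass (c : ℝ) (x z : Site (d + 1)) (α β : Fin (d + 1)) :
    |(c • mmRead N (comp (comp K V) K)) x z (Sum.inl α) (Sum.inl β)|
      ≤ |c| * ((Fintype.card (Fib d) : ℝ) * ((Fintype.card (Fib d) : ℝ) * (hL * BΦ * (Zl (d + 1) m' * ∑' p, ω p * E x p)) * hR)) := by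
  obtain ⟨h1, h2, h3⟩ := tsum_tsum_weight (a := ω) (m' := m') hm hω hωs (w := E x) (fun p => (hE x p).1) (fun p => (hE x p).2)
  simp only [Pi.smul_apply, smul_eq_mul]
  rw [abs_mul, mmRead_inl_inl]
  refine mul_le_mul_of_nonneg_left ?_ (abs_nonneg _)
  -- the outer composition against the right leg
  have hinner : ∀ (q : Site (d + 1)) (g : Fib d), |comp K V ((N : ℤ) • x) q (Sum.inr α) g|
      ≤ (Fintype.card (Fib d) : ℝ) * (hL * BΦ * ∑' p, ω p * Real.exp (-m' * l1 (q - p)) * E x p) :=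
    fun q g => abs_comp_le_weighted hm hE hω hωs hKL hV x q α g
  have hI0 : ∀ q, 0 ≤ ∑' p, ω p * Real.exp (-m' * l1 (q - p)) * E x p :=
    fun q => tsum_nonneg fun p => mul_nonneg (mul_nonneg (hω p) (Real.exp_nonneg _)) (hE x p).1
  show |comp (comp K V) K ((N : ℤ) • x) ((N : ℤ) • z) (Sum.inr α) (Sum.inr β)| ≤ _
  unfold ExpKernelCalculus.comp
  have hmaj := ((h2.mul_left ((Fintype.card (Fib d) : ℝ) * (hL * BΦ))).mul_right hR).mul_left (Fintype.card (Fib d) : ℝ)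
  have hb := tsum_of_norm_bounded hmaj.hasSum (fun q => by
    rw [Real.norm_eq_abs]
    calc |∑ g, (∑' p, ∑ f, K ((N : ℤ) • x) p (Sum.inr α) f * V p q f g) * K q ((N : ℤ) • z) g (Sum.inr β)|
        ≤ ∑ g, |(∑' p, ∑ f, K ((N : ℤ) • x) p (Sum.inr α) f * V p q f g) * K q ((N : ℤ) • z) g (Sum.inr β)| := Finset.abs_sum_le_sum_abs _ _
      _ ≤ ∑ _g : Fib d, ((Fintype.card (Fib d) : ℝ) * (hL * BΦ * ∑' p, ω p * Real.exp (-m' * l1 (q - p)) * E x p)) * hR :=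
          Finset.sum_le_sum fun g _ => by
            rw [abs_mul]
            exact mul_le_mul (hinner q g) (hKR q z g β) (abs_nonneg _) (mul_nonneg (Nat.cast_nonneg _) (mul_nonneg (mul_nonneg hhL hB) (hI0 q)))
      _ = (Fintype.card (Fib d) : ℝ) * (((Fintype.card (Fib d) : ℝ) * (hL * BΦ)) * (∑' p, ω p * Real.exp (-m' * l1 (q - p)) * E x p) * hR) := by
          rw [Finset.sum_const, Finset.card_univ, nsmul_eq_mul]; ring)
  rw [Real.norm_eq_abs] at hb
  refine hb.trans (le_of_eq ?_)
  rw [tsum_mul_left, tsum_mul_right, tsum_mul_left, h3]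
  ring

include hhL hB hm hE hω hωs hKL hKR hV in
/-- NOT IN PRINT; OUR BOOKKEEPING.  **THE PER-LEVEL FACTOR IN `Bdd` CURRENCY** (the socket shape of leaf-03 g62's `BlockFluxRegion` ∕ `BlockFluxTower`): if every output window
sees flux mass at most `M_F` (`∀ x, Σ'_p ω(p)·E_x(p) ≤ M_F`), then `Bdd (c • mmRead N (K ∘ V ∘ K)) (|c|·|Fib d|²·h_L·h_R·B_Φ·Zl(m′)·M_F)` — to be compared with the
support-blind `|c_H|·|Fib d|²·(C·Z_δ)²·B_Φ`.  READING (R-1, a count, not asserted): for the face weight of ONE `Lc`-block boundary sub-letter `M_F ≍ Lc^d`. -/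
theorem bdd_smul_mmRead_sandwich_of_faceMass (hhR : 0 ≤ hR) (c : ℝ) {MF : ℝ} (hM : ∀ x, ∑' p, ω p * E x p ≤ MF) :
    KernelWard.Bdd (c • mmRead N (comp (comp K V) K))
      (|c| * ((Fintype.card (Fib d) : ℝ) * ((Fintype.card (Fib d) : ℝ) * (hL * BΦ * (Zl (d + 1) m' * MF)) * hR))) := by
  have hMF : 0 ≤ MF := (tsum_nonneg fun p => mul_nonneg (hω p) (hE 0 p).1).trans (hM 0)
  have hbound : 0 ≤ |c| * ((Fintype.card (Fib d) : ℝ) * ((Fintype.card (Fib d) : ℝ) * (hL * BΦ * (Zl (d + 1) m' * MF)) * hR)) :=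
    mul_nonneg (abs_nonneg _) (mul_nonneg (Nat.cast_nonneg _) (mul_nonneg (mul_nonneg (Nat.cast_nonneg _)
      (mul_nonneg (mul_nonneg hhL hB) (mul_nonneg (Zl_nonneg hm) hMF))) hhR))
  intro x z a b
  rcases a with α | μ
  · rcases b with β | ν
    · refine (abs_smul_mmRead_sandwich_le_faceMass hhL hB hm hE hω hωs hKL hKR hV c x z α β).trans ?_
      have h0 : 0 ≤ |c| * ((Fintype.card (Fib d) : ℝ) * ((Fintype.card (Fib d) : ℝ) * (hL * BΦ))) * hR :=
        mul_nonneg (mul_nonneg (abs_nonneg _) (mul_nonneg (Nat.cast_nonneg _) (mul_nonneg (Nat.cast_nonneg _) (mul_nonneg hhL hB)))) hhR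
      have h1 : Zl (d + 1) m' * (∑' p, ω p * E x p) ≤ Zl (d + 1) m' * MF := mul_le_mul_of_nonneg_left (hM x) (Zl_nonneg hm)
      have h2 := mul_le_mul_of_nonneg_left h1 h0
      nlinarith [h2]
    · simp only [Pi.smul_apply, smul_eq_mul, BalabanStepJetsSucc.mmRead_inr_right, mul_zero, abs_zero]; exact hbound
  · simp only [Pi.smul_apply, smul_eq_mul, BalabanStepJetsSucc.mmRead_inr_left, mul_zero, abs_zero]; exact hbound

end Sandwich

/-! ## §2 The flux kernel of a letter under the (LAY) profile row has the weighted shape of §1 -/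

section Profile

variable {S : Fin (d + 1) → Site (d + 1) → MKer (d + 1) (Fib d)} {ω : Site (d + 1) → ℝ} {Cs m' : ℝ}
  (hCs : 0 ≤ Cs) (hm : 0 ≤ m') (hω : ∀ u, 0 ≤ ω u)
  (hS : ∀ k' u x z a b, |S k' u x z a b| ≤ Cs * ω u * Real.exp (-m' * (l1 (x - u) + l1 (z - u))))

omit hCs hω hS in
include hm in
/-- [folklore] Splitting the two-sided profile: `e^{−m′(‖p−u‖₁+‖q−u‖₁)} ≤ e^{−(m′/2)‖p−u‖₁}·e^{−(m′/2)‖q−p‖₁}` (triangle inequality through `u`). -/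
theorem exp_profile_le_split (p q u : Site (d + 1)) :
    Real.exp (-m' * (l1 (p - u) + l1 (q - u))) ≤ Real.exp (-(m' / 2) * l1 (p - u)) * Real.exp (-(m' / 2) * l1 (q - p)) := by
  rw [← Real.exp_add]
  refine Real.exp_le_exp.2 ?_
  have ht : l1 (q - p) ≤ l1 (q - u) + l1 (u - p) := l1_sub_triangle q u p
  rw [l1_sub_symm u p] at ht
  nlinarith [l1_nonneg (p - u), l1_nonneg (q - u)]

include hCs hm hω hS in
/-- NOT IN PRINT; OUR BOOKKEEPING.  **THE FLUX KERNEL OF A LETTER THROUGH ANY FINITE REGION HAS THE WEIGHTED SHAPE OF §1** under the (LAY) profile row: with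
`ω̃ u = e^{2m′}·Σ_κ ω(u−e_κ) + (d+1)·ω u` (my `GaugeTableSlotByParts.abs_divV_apply_le_of_profile`),
`|(Σ_{u∈R} divV S u) p q a b| ≤ Cs·(Σ_{u∈R} ω̃(u)·e^{−(m′/2)‖p−u‖₁})·e^{−(m′/2)‖q−p‖₁}` — i.e. `B_Φ = Cs`, slot weight `ω_Φ(p) = Σ_{u∈R} ω̃(u)e^{−(m′/2)‖p−u‖₁}` (the
`m′/2`-smear of the letter's face weight over the region), kernel-range rate `m′/2`. -/
theorem abs_finsetSum_divV_le_of_profile (R : Finset (Site (d + 1))) (p q : Site (d + 1)) (a b : Fib d) :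
    |(∑ u ∈ R, divV S u) p q a b|
      ≤ Cs * (∑ u ∈ R, (Real.exp (2 * m') * (∑ κ : Fin (d + 1), ω (u - AffineAveraging.unitVec κ)) + ((d : ℝ) + 1) * ω u)
          * Real.exp (-(m' / 2) * l1 (p - u))) * Real.exp (-(m' / 2) * l1 (q - p)) := by
  rw [Finset.sum_apply, Finset.sum_apply, Finset.sum_apply, Finset.sum_apply]
  refine (Finset.abs_sum_le_sum_abs _ _).trans ?_
  rw [Finset.mul_sum, Finset.sum_mul]
  refine Finset.sum_le_sum fun u _ => ?_
  have hωt : 0 ≤ Real.exp (2 * m') * (∑ κ : Fin (d + 1), ω (u - AffineAveraging.unitVec κ)) + ((d : ℝ) + 1) * ω u :=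
    add_nonneg (mul_nonneg (Real.exp_nonneg _) (Finset.sum_nonneg fun κ _ => hω _)) (mul_nonneg (by positivity) (hω u))
  calc |divV S u p q a b|
      ≤ Cs * (Real.exp (2 * m') * (∑ κ : Fin (d + 1), ω (u - AffineAveraging.unitVec κ)) + ((d : ℝ) + 1) * ω u)
          * Real.exp (-m' * (l1 (p - u) + l1 (q - u))) := abs_divV_apply_le_of_profile hCs hm hω hS u p q a b
    _ ≤ Cs * (Real.exp (2 * m') * (∑ κ : Fin (d + 1), ω (u - AffineAveraging.unitVec κ)) + ((d : ℝ) + 1) * ω u)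
          * (Real.exp (-(m' / 2) * l1 (p - u)) * Real.exp (-(m' / 2) * l1 (q - p))) :=
        mul_le_mul_of_nonneg_left (exp_profile_le_split hm p q u) (mul_nonneg hCs hωt)
    _ = Cs * ((Real.exp (2 * m') * (∑ κ : Fin (d + 1), ω (u - AffineAveraging.unitVec κ)) + ((d : ℝ) + 1) * ω u)
          * Real.exp (-(m' / 2) * l1 (p - u))) * Real.exp (-(m' / 2) * l1 (q - p)) := by ring

omit hCs hω hS in
/-- [folklore] The smeared region weight `ω_Φ(p) = Σ_{u∈R} c(u)·e^{−(m′/2)‖p−u‖₁}` is nonnegative for `c ≥ 0` and summable in `p` for `m′ > 0` (finite sum of shifted exponential sums). -/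
theorem summable_regionWeight (hm0 : 0 < m') (R : Finset (Site (d + 1))) (c : Site (d + 1) → ℝ) :
    Summable fun p : Site (d + 1) => ∑ u ∈ R, c u * Real.exp (-(m' / 2) * l1 (p - u)) :=
  summable_sum fun u _ => (summable_exp_shift' (half_pos hm0) u).mul_left (c u)

end Profile

end Summit.QuantumFields.BalabanUV.Beta.GAN24.BoundaryFluxFaceCount

end
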